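import Mathlib
import Literature.NumberTheory.Sieve.GoldbachLinnikCounts
import HarnessLib

/-!
# Goldbach–Linnik numbers: the dispersion method of Pintz–Ruzsa I, §10

Topic `Literature/NumberTheory/Sieve`; support file for the named fact
`Literature.NumberTheory.Sieve.goldbach_linnik` (parity.S36). Sequel to `GoldbachLinnikCounts.lean`.

We formalise the *dispersion method* step of Pintz–Ruzsa, *On Linnik's approximation to
Goldbach's problem, I*, Acta Arith. 109 (2003), §10, (10.8)–(10.16) (which follows Gallagher,
Invent. Math. 29 (1975), and Liu–Liu–Wang [LLW1]): writing `r'_k(n) = ρ_k + s_k(n)` with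
`ρ_k = 2L^k / log N` ((10.9), (10.11)),

  `∑_{m+n=N} r'_i(m) r'_j(n) = ρ_i ρ_j · N/2 + ρ_i ∑ s_j + ρ_j ∑ s_i + ∑ s_i(m) s_j(n)`  (10.12)

and by Cauchy's inequality the last sum is at most `(∑ s_i²)^{1/2} (∑ s_j²)^{1/2}` (10.14), where
the dispersion `∑_{n ≤ N, 2∤n} s_k(n)² = ∑ r'_k² - 2ρ_k ∑ r'_k + ρ_k² N/2` (10.8) is controlled by the
first moment (Lemma 14: `∑ r'_k(n) ~ N L^k / log N`) and the second moment (Lemma 13: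
`∑ r'_k(n)² ≤ (2NL^{2k}/log² N)(1 + B_k + ε)`). The outcome, proved here with the two moment
estimates as explicit hypotheses:

* `pairSum_sub_sq_le` — the exact inequality (10.12) + (10.14) for even `N` (in squared form);
* `dispersion_eq`, `dispersion_le` — (10.8) and its evaluation from the two moment estimates;
* `eventually_pairSum_pos` — if `∑ r'_k ~ NL^k/log N` (`k = i, j`) and
  `∑ r'_k² ≤ (1 + B_k + ε) 2NL^{2k}/log²N` eventually for every `ε > 0`, with `B_i B_j < 1`, then
  `∑_{m+n=N} r'_i(m) r'_j(n) > 0` for all large even `N` ((10.15)–(10.16): the main term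
  `2NL^K/log²N` beats `2NL^K/log²N · (B_i B_j)^{1/2}`);
* `goldbach_linnik_of_moments` — hence `goldbach_linnik` when moreover `i + j ≤ 8`
  (Part II: `i = j = 4`).

The first-moment hypothesis is discharged unconditionally from the prime number theorem in
`GoldbachLinnikFirstMoment.lean`; the second-moment bound with `B_4 < 1` is Pintz–Ruzsa's
Lemma 13 in its unconditional form (Part II), the analytic heart of the theorem, and is NOT
proved in the tree. No named facts are introduced here.

## References

* J. Pintz, I. Z. Ruzsa, *On Linnik's approximation to Goldbach's problem, I*, Acta Arith. 109
  (2003) 169–194, §10: (10.8)–(10.16), Lemmas 13–14. [PintzRuzsa2003]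
* P. X. Gallagher, *Primes and powers of 2*, Invent. Math. 29 (1975) 125–142. [Gallagher1975]
-/

open Finset Filter

open scoped Topology

namespace Literature.NumberTheory.Sieve

namespace GoldbachLinnik

/-! ### The main terms -/

/-- `ρ_k = ρ_k(N) = 2 L^k / log N`, the mean value of `r'_k(n)` over odd `n ≤ N`
(Pintz–Ruzsa I (10.9), (10.11)). [cite: PintzRuzsa2003, (10.9)] -/
noncomputable def meanDensity (N k : ℕ) : ℝ := 2 * (powLen N : ℝ) ^ k / Real.log N

/-- The main term `N L^k / log N` of the first moment `∑_{n ≤ N} r'_k(n)` (Pintz–Ruzsa I (10.7)).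
[cite: PintzRuzsa2003, (10.7)] -/
noncomputable def firstMain (N k : ℕ) : ℝ := (N : ℝ) * (powLen N : ℝ) ^ k / Real.log N

/-- The main term `2 N L^{2k} / log² N` of the second moment `∑_{n ≤ N} r'_k(n)²`
(Pintz–Ruzsa I (10.1)). [cite: PintzRuzsa2003, (10.1)] -/
noncomputable def secondMain (N k : ℕ) : ℝ :=
  2 * (N : ℝ) * (powLen N : ℝ) ^ (2 * k) / Real.log N ^ 2

/-- The dispersion `E = ∑_{n ≤ N, 2 ∤ n} (r'_k(n) - ρ_k)²` (Pintz–Ruzsa I (10.8)), over odd `n < N`.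
[cite: PintzRuzsa2003, (10.8)] -/
noncomputable def dispersion (N k : ℕ) : ℝ :=
  ∑ n ∈ oddBelow N, ((repPrimePow N k n : ℝ) - meanDensity N k) ^ 2

/-- **Pintz–Ruzsa I (10.8)**: `E = ∑ r'_k² - 2ρ_k ∑ r'_k + ρ_k² #{n < N odd}`.
[cite: PintzRuzsa2003, (10.8)] -/
theorem dispersion_eq (N k : ℕ) :
    dispersion N k = (secondMoment N k : ℝ) - 2 * meanDensity N k * (firstMoment N k : ℝ) +
      meanDensity N k ^ 2 * ((oddBelow N).card : ℝ) := by
  have h : ∀ n, ((repPrimePow N k n : ℝ) - meanDensity N k) ^ 2 =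
      (repPrimePow N k n : ℝ) ^ 2 - 2 * meanDensity N k * (repPrimePow N k n : ℝ) +
        meanDensity N k ^ 2 := fun n => by ring
  simp_rw [dispersion, h, Finset.sum_add_distrib, Finset.sum_sub_distrib, Finset.sum_const,
    ← Finset.mul_sum, nsmul_eq_mul, secondMoment, firstMoment]
  push_cast
  ring

/-- The dispersion is nonnegative. [folklore] -/
theorem dispersion_nonneg (N k : ℕ) : 0 ≤ dispersion N k :=
  Finset.sum_nonneg fun _ _ => sq_nonneg _

/-- **Pintz–Ruzsa I (10.12) with Cauchy's inequality (10.14)**, for even `N`: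
`∑_{m+n=N} r'_i(m) r'_j(n) ≥ ρ_iρ_j · #O + ρ_i (∑_O r'_j - ρ_j #O) + ρ_j (∑_O r'_i - ρ_i #O) - (E_i E_j)^{1/2}`,
`O` the odd numbers below `N`; stated in squared form: the deviation of the pair sum from the
first three terms has square at most `E_i E_j`. [cite: PintzRuzsa2003, (10.12)–(10.14)] -/
theorem pairSum_sub_sq_le {N : ℕ} (hN : Even N) (i j : ℕ) :
    ((pairSum N i j : ℝ) - (meanDensity N i * meanDensity N j * (oddBelow N).card +
        meanDensity N i * ((firstMoment N j : ℝ) - meanDensity N j * (oddBelow N).card) +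
        meanDensity N j * ((firstMoment N i : ℝ) - meanDensity N i * (oddBelow N).card))) ^ 2 ≤
      dispersion N i * dispersion N j := by
  set ρi := meanDensity N i
  set ρj := meanDensity N j
  set s : ℕ → ℝ := fun m => (repPrimePow N i m : ℝ) - ρi
  set t : ℕ → ℝ := fun m => (repPrimePow N j (N - m) : ℝ) - ρj
  have hpair : (pairSum N i j : ℝ) = ∑ m ∈ oddBelow N, (ρi + s m) * (ρj + t m) := by
    simp only [pairSum, Nat.cast_sum, Nat.cast_mul, s, t]
    refine Finset.sum_congr rfl fun m _ => by ring
  have ht : ∑ m ∈ oddBelow N, t m = (firstMoment N j : ℝ) - ρj * (oddBelow N).card := by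
    simp only [t, Finset.sum_sub_distrib, Finset.sum_const, nsmul_eq_mul, firstMoment, Nat.cast_sum]
    rw [sum_oddBelow_sub hN (fun m => (repPrimePow N j m : ℝ))]
    ring
  have hs : ∑ m ∈ oddBelow N, s m = (firstMoment N i : ℝ) - ρi * (oddBelow N).card := by
    simp only [s, Finset.sum_sub_distrib, Finset.sum_const, nsmul_eq_mul, firstMoment, Nat.cast_sum]
    ring
  have ht2 : ∑ m ∈ oddBelow N, t m ^ 2 = dispersion N j := by
    simp only [t, dispersion]
    exact sum_oddBelow_sub hN (fun m => ((repPrimePow N j m : ℝ) - ρj) ^ 2)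
  have hs2 : ∑ m ∈ oddBelow N, s m ^ 2 = dispersion N i := rfl
  have hexp : ∑ m ∈ oddBelow N, (ρi + s m) * (ρj + t m) =
      ρi * ρj * (oddBelow N).card + ρi * ∑ m ∈ oddBelow N, t m + ρj * ∑ m ∈ oddBelow N, s m +
        ∑ m ∈ oddBelow N, s m * t m := by
    have : ∀ m, (ρi + s m) * (ρj + t m) = ρi * ρj + ρi * t m + ρj * s m + s m * t m :=
      fun m => by ring
    simp_rw [this, Finset.sum_add_distrib, Finset.sum_const, nsmul_eq_mul, ← Finset.mul_sum]
    ring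
  have hkey : (pairSum N i j : ℝ) - (ρi * ρj * (oddBelow N).card +
      ρi * ((firstMoment N j : ℝ) - ρj * (oddBelow N).card) +
      ρj * ((firstMoment N i : ℝ) - ρi * (oddBelow N).card)) = ∑ m ∈ oddBelow N, s m * t m := by
    rw [hpair, hexp, ht, hs]; ring
  rw [hkey, ← hs2, ← ht2]
  exact Finset.sum_mul_sq_le_sq_mul_sq _ _ _

/-! ### Asymptotic evaluation -/

/-- For `N ≥ 2`: `log N > 0`. [folklore] -/
theorem log_pos_of_two_le {N : ℕ} (hN : 2 ≤ N) : 0 < Real.log N :=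
  Real.log_pos (by exact_mod_cast hN)

/-- For `N ≥ 2`: `L = [log₂ N] ≥ 1`. [folklore] -/
theorem powLen_pos {N : ℕ} (hN : 2 ≤ N) : 0 < powLen N :=
  Nat.log_pos one_lt_two hN

/-- `ρ_k · (N/2) = N L^k / log N`. [cite: PintzRuzsa2003, (10.9)] -/
theorem meanDensity_mul_half (N k : ℕ) :
    meanDensity N k * ((N : ℝ) / 2) = firstMain N k := by
  simp only [meanDensity, firstMain]; ring

/-- `ρ_i · (N L^j / log N) = 2 N L^{i+j} / log² N` (the main term (10.16)).
[cite: PintzRuzsa2003, (10.16)] -/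
theorem meanDensity_mul_firstMain (N i j : ℕ) :
    meanDensity N i * firstMain N j =
      2 * (N : ℝ) * (powLen N : ℝ) ^ (i + j) / Real.log N ^ 2 := by
  simp only [meanDensity, firstMain, pow_add]; ring

/-- `secondMain N k = ρ_k · firstMain N k`. [cite: PintzRuzsa2003, (10.8)] -/
theorem secondMain_eq (N k : ℕ) : secondMain N k = meanDensity N k * firstMain N k := by
  rw [meanDensity_mul_firstMain, secondMain, two_mul k]

/-- **Dispersion bound (Pintz–Ruzsa I (10.8) with Lemmas 13, 14 as hypotheses).** If at some
even `N ≥ 2` the first moment is within a factor `1 ± ε` of `N L^k/log N` and the second moment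
is at most `(1 + B + ε) · 2NL^{2k}/log² N`, then `E_k ≤ (B + 3ε) · 2 N L^{2k} / log² N`.
[cite: PintzRuzsa2003, (10.8)] -/
theorem dispersion_le {N k : ℕ} (hN : Even N) {B ε : ℝ}
    (hM : (1 - ε) * firstMain N k ≤ (firstMoment N k : ℝ))
    (hV : (secondMoment N k : ℝ) ≤ (1 + B + ε) * secondMain N k) :
    dispersion N k ≤ (B + 3 * ε) * secondMain N k := by
  rw [dispersion_eq, card_oddBelow_real hN]
  have hρ : 0 ≤ meanDensity N k := by
    unfold meanDensity
    rcases Nat.lt_or_ge N 2 with h | h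
    · interval_cases N <;> simp [powLen]
    · exact div_nonneg (by positivity) (log_pos_of_two_le h).le
  have h1 : meanDensity N k * ((1 - ε) * firstMain N k) ≤ meanDensity N k * (firstMoment N k : ℝ) :=
    mul_le_mul_of_nonneg_left hM hρ
  have h2 : meanDensity N k ^ 2 * ((N : ℝ) / 2) = secondMain N k := by
    rw [sq, mul_assoc, meanDensity_mul_half, secondMain_eq]
  rw [h2]
  rw [secondMain_eq] at hV ⊢
  nlinarith [h1, hV]

/-- From `∑ r'_k ~ N L^k / log N`: for every `ε > 0`, eventually
`(1-ε) NL^k/log N ≤ ∑ r'_k ≤ (1+ε) NL^k/log N`. [cite: PintzRuzsa2003, Lemma 14] -/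
theorem eventually_firstMoment_bounds {k : ℕ} {ε : ℝ} (hε : 0 < ε)
    (hM : Tendsto (fun N : ℕ => (firstMoment N k : ℝ) / firstMain N k) atTop (𝓝 1)) :
    ∀ᶠ N : ℕ in atTop, (1 - ε) * firstMain N k ≤ (firstMoment N k : ℝ) ∧
      (firstMoment N k : ℝ) ≤ (1 + ε) * firstMain N k := by
  have h := Metric.tendsto_nhds.1 hM ε hε
  filter_upwards [h, eventually_ge_atTop 2] with N hN hN2
  have hF : 0 < firstMain N k := by
    unfold firstMain
    have := powLen_pos hN2
    have := log_pos_of_two_le hN2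
    positivity
  rw [Real.dist_eq, abs_lt, sub_lt_iff_lt_add, lt_sub_iff_add_lt, div_lt_iff₀ hF,
    lt_div_iff₀ hF] at hN
  constructor <;> nlinarith [hN.1, hN.2]

/-- Choice of `ε` in the final comparison: if `B_i B_j < 1` then for some `ε > 0`,
`(B_i + 3ε)(B_j + 3ε) < (1 - 2ε)²` and `2ε < 1`. [folklore] -/
theorem exists_eps_of_mul_lt_one {Bi Bj : ℝ} (hBi : 0 ≤ Bi) (hBj : 0 ≤ Bj) (hB : Bi * Bj < 1) :
    ∃ ε : ℝ, 0 < ε ∧ 2 * ε < 1 ∧ (Bi + 3 * ε) * (Bj + 3 * ε) < (1 - 2 * ε) ^ 2 := by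
  have hden : 0 < 3 * Bi + 3 * Bj + 13 := by positivity
  set ε : ℝ := (1 - Bi * Bj) / (3 * Bi + 3 * Bj + 13) with hε
  have hε0 : 0 < ε := div_pos (by linarith) hden
  have hεkey : ε * (3 * Bi + 3 * Bj + 13) = 1 - Bi * Bj := by rw [hε]; field_simp
  have hBB := mul_nonneg hBi hBj
  have hε1 : ε * 13 ≤ 1 := by nlinarith
  have hεε : 13 * (ε * ε) ≤ ε := by nlinarith
  refine ⟨ε, hε0, by nlinarith, ?_⟩
  have hlhs : (Bi + 3 * ε) * (Bj + 3 * ε) = 1 - 13 * ε + 9 * ε ^ 2 := by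
    linear_combination hεkey
  rw [hlhs]
  nlinarith

/-- **Pintz–Ruzsa I, §10, (10.12)–(10.16): positivity of the pair sum.** Suppose that for
`k = i` and `k = j` the first moment satisfies `∑_{n<N odd} r'_k(n) ~ N L^k / log N` (Lemma 14) and
the second moment satisfies, for every `ε > 0` and all large `N`,
`∑_{n<N odd} r'_k(n)² ≤ (1 + B_k + ε) · 2NL^{2k}/log² N` (Lemma 13 with `B_k = A(k) + C₂'(1-η)^{2k-2}`),
where `B_i, B_j ≥ 0` and `B_i B_j < 1`. Then `∑_{m+n=N} r'_i(m) r'_j(n) > 0` for all sufficiently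
large even `N`. [cite: PintzRuzsa2003, §10 (10.12)–(10.16)] -/
theorem eventually_pairSum_pos {i j : ℕ} {Bi Bj : ℝ} (hBi : 0 ≤ Bi) (hBj : 0 ≤ Bj)
    (hB : Bi * Bj < 1)
    (hMi : Tendsto (fun N : ℕ => (firstMoment N i : ℝ) / firstMain N i) atTop (𝓝 1))
    (hMj : Tendsto (fun N : ℕ => (firstMoment N j : ℝ) / firstMain N j) atTop (𝓝 1))
    (hVi : ∀ ε : ℝ, 0 < ε → ∀ᶠ N : ℕ in atTop,
      (secondMoment N i : ℝ) ≤ (1 + Bi + ε) * secondMain N i)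
    (hVj : ∀ ε : ℝ, 0 < ε → ∀ᶠ N : ℕ in atTop,
      (secondMoment N j : ℝ) ≤ (1 + Bj + ε) * secondMain N j) :
    ∃ N₀ : ℕ, ∀ N, N₀ ≤ N → Even N → 0 < pairSum N i j := by
  obtain ⟨ε, hε0, hε2, hgap⟩ := exists_eps_of_mul_lt_one hBi hBj hB
  -- gather the eventual hypotheses
  obtain ⟨N₀, hN₀⟩ := eventually_atTop.1 ((eventually_firstMoment_bounds hε0 hMi).and
    ((eventually_firstMoment_bounds hε0 hMj).and ((hVi ε hε0).and ((hVj ε hε0).and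
      (eventually_ge_atTop 2)))))
  refine ⟨N₀, fun N hN hNe => ?_⟩
  obtain ⟨⟨hMi1, -⟩, ⟨hMj1, -⟩, hVi', hVj', hN2⟩ := hN₀ N hN
  -- positivity of the scales
  have hL : 0 < (powLen N : ℝ) := by exact_mod_cast powLen_pos hN2
  have hlog : 0 < Real.log N := log_pos_of_two_le hN2
  have hNpos : 0 < (N : ℝ) := by exact_mod_cast (lt_of_lt_of_le two_pos hN2)
  have hΨpos : 0 < 2 * (N : ℝ) * (powLen N : ℝ) ^ (i + j) / Real.log N ^ 2 := by positivity
  -- the dispersion bounds (10.8) + Lemmas 13, 14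
  have hDi : dispersion N i ≤ (Bi + 3 * ε) * secondMain N i := dispersion_le hNe hMi1 hVi'
  have hDj : dispersion N j ≤ (Bj + 3 * ε) * secondMain N j := dispersion_le hNe hMj1 hVj'
  have hSS : secondMain N i * secondMain N j =
      (2 * (N : ℝ) * (powLen N : ℝ) ^ (i + j) / Real.log N ^ 2) ^ 2 := by
    simp only [secondMain, pow_add, pow_mul]; ring
  have hDD : dispersion N i * dispersion N j ≤ (Bi + 3 * ε) * (Bj + 3 * ε) *
      (2 * (N : ℝ) * (powLen N : ℝ) ^ (i + j) / Real.log N ^ 2) ^ 2 := by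
    calc dispersion N i * dispersion N j
        ≤ ((Bi + 3 * ε) * secondMain N i) * ((Bj + 3 * ε) * secondMain N j) :=
          mul_le_mul hDi hDj (dispersion_nonneg N j) ((dispersion_nonneg N i).trans hDi)
      _ = _ := by rw [← hSS]; ring
  -- main term (10.16) and the cross terms (10.13)
  have hcard : ((oddBelow N).card : ℝ) = (N : ℝ) / 2 := card_oddBelow_real hNe
  have hmain : meanDensity N i * meanDensity N j * (oddBelow N).card =
      2 * (N : ℝ) * (powLen N : ℝ) ^ (i + j) / Real.log N ^ 2 := by
    rw [hcard, mul_assoc, meanDensity_mul_half, meanDensity_mul_firstMain]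
  have hρi : 0 ≤ meanDensity N i := by unfold meanDensity; positivity
  have hρj : 0 ≤ meanDensity N j := by unfold meanDensity; positivity
  have hcross1 : -(ε * (2 * (N : ℝ) * (powLen N : ℝ) ^ (i + j) / Real.log N ^ 2)) ≤
      meanDensity N i * ((firstMoment N j : ℝ) - meanDensity N j * (oddBelow N).card) := by
    rw [hcard, meanDensity_mul_half]
    calc -(ε * (2 * (N : ℝ) * (powLen N : ℝ) ^ (i + j) / Real.log N ^ 2))
          = meanDensity N i * (-(ε * firstMain N j)) := by
            simp only [meanDensity, firstMain, pow_add]; ring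
      _ ≤ meanDensity N i * ((firstMoment N j : ℝ) - firstMain N j) :=
            mul_le_mul_of_nonneg_left (by linarith) hρi
  have hcross2 : -(ε * (2 * (N : ℝ) * (powLen N : ℝ) ^ (i + j) / Real.log N ^ 2)) ≤
      meanDensity N j * ((firstMoment N i : ℝ) - meanDensity N i * (oddBelow N).card) := by
    rw [hcard, meanDensity_mul_half]
    calc -(ε * (2 * (N : ℝ) * (powLen N : ℝ) ^ (i + j) / Real.log N ^ 2))
          = meanDensity N j * (-(ε * firstMain N i)) := by
            simp only [meanDensity, firstMain, pow_add]; ring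
      _ ≤ meanDensity N j * ((firstMoment N i : ℝ) - firstMain N i) :=
            mul_le_mul_of_nonneg_left (by linarith) hρj
  -- Cauchy's inequality (10.14)
  have hCS := pairSum_sub_sq_le hNe i j
  rw [hmain] at hCS
  have hT2 : ((pairSum N i j : ℝ) - (2 * (N : ℝ) * (powLen N : ℝ) ^ (i + j) / Real.log N ^ 2 +
      meanDensity N i * ((firstMoment N j : ℝ) - meanDensity N j * (oddBelow N).card) +
      meanDensity N j * ((firstMoment N i : ℝ) - meanDensity N i * (oddBelow N).card))) ^ 2 <
      ((1 - 2 * ε) * (2 * (N : ℝ) * (powLen N : ℝ) ^ (i + j) / Real.log N ^ 2)) ^ 2 := by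
    calc _ ≤ dispersion N i * dispersion N j := hCS
      _ ≤ _ := hDD
      _ < (1 - 2 * ε) ^ 2 * (2 * (N : ℝ) * (powLen N : ℝ) ^ (i + j) / Real.log N ^ 2) ^ 2 := by
          gcongr
      _ = _ := by ring
  have h12 : 0 ≤ (1 - 2 * ε) * (2 * (N : ℝ) * (powLen N : ℝ) ^ (i + j) / Real.log N ^ 2) :=
    mul_nonneg (by linarith) hΨpos.le
  have hTlt := (abs_lt.1 (abs_lt_of_sq_lt_sq hT2 h12)).1
  have hreal : (0 : ℝ) < (pairSum N i j : ℝ) := by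
    have hεΨ : 0 < ε * (2 * (N : ℝ) * (powLen N : ℝ) ^ (i + j) / Real.log N ^ 2) :=
      mul_pos hε0 hΨpos
    linarith [hcross1, hcross2, hTlt]
  exact Nat.cast_pos.1 hreal

/-- **Pintz–Ruzsa I, Theorem 1 / Part II main theorem, modulo Lemmas 13–14.** If for `k = i, j`
(`i + j ≤ 8`) the first moments satisfy Lemma 14 and the second moments satisfy Lemma 13-type
bounds `∑ r'_k² ≤ (1 + B_k + ε) 2NL^{2k}/log²N` with `B_i B_j < 1`, then every sufficiently large
even `N` is a sum of two primes and at most `8` powers of two (`goldbach_linnik`). Part II takes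
`i = j = 4`. [cite: PintzRuzsa2003, §10 (proof of Theorem 1)] -/
theorem goldbach_linnik_of_moments {i j : ℕ} (hij : i + j ≤ 8) {Bi Bj : ℝ} (hBi : 0 ≤ Bi)
    (hBj : 0 ≤ Bj) (hB : Bi * Bj < 1)
    (hMi : Tendsto (fun N : ℕ => (firstMoment N i : ℝ) / firstMain N i) atTop (𝓝 1))
    (hMj : Tendsto (fun N : ℕ => (firstMoment N j : ℝ) / firstMain N j) atTop (𝓝 1))
    (hVi : ∀ ε : ℝ, 0 < ε → ∀ᶠ N : ℕ in atTop,
      (secondMoment N i : ℝ) ≤ (1 + Bi + ε) * secondMain N i)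
    (hVj : ∀ ε : ℝ, 0 < ε → ∀ᶠ N : ℕ in atTop,
      (secondMoment N j : ℝ) ≤ (1 + Bj + ε) * secondMain N j) :
    goldbach_linnik :=
  goldbach_linnik_of_pairSum_pos hij (eventually_pairSum_pos hBi hBj hB hMi hMj hVi hVj)

end GoldbachLinnik

end Literature.NumberTheory.Sieve
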